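import Summits.QuantumFields.YangMills.Theorems.BalabanUVNodesN07DatumCrownOfRecordCrown
import Literature.MathematicalPhysics.QuantumFieldTheory.Balaban1983to89.B8Prop6DentedCubeMemberScalarGammaSU25PrecompRec
import HarnessLib

/-!
# N07 [B11] (= [15] = [Balaban1985Variational]) Sect. F — **THE PRE-COMPOSED RECORD CROWN IN ITS `SU(N)` EDITION, AS A NAMED PREMISE SHAPE, AND ITS INHABITANT FOR
# `N ≤ 25`**: `RecordCrownSUPrecompBody L N B₀ c₁ ρ₀ M₀ N₀ R₀` ∕ `RecordCrownSUPrecomp L N` (road (B′), director-ym №310–№312a branch (ii) case (β)) — the receiving socket of the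
# N05-REC → K0-road junction for dag-n05-e g42's (B′-4)·4 run (v1: the SHAPE; v1.1 will add `recordCrownSUPrecomp_holds_of_le (hN : N ≤ 25)` by ONE `exact` from F8 once it lands)

Cell `pub-ymgap`, width seat `pub-ymgap-dag-n07-w3` g13 (junction side of the K0 road).  `--kind definition --supports stmt-QuantumFields-20541 --as helper` (K0⁷; count-neutral).
TWO `def`s (a displayed premise SHAPE and its constants-bound form — NEVER asserted) + theorems.  No `instance`, no `notation`, no `sorry`.
[6] = [Balaban1985RegularSpaces]; [15] = [Balaban1985Variational]; [3] = [Balaban1985Averaging]; [I] = [Balaban1987RG1].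

WHY.  Under A3⁵ ∕ №312a (β) the premise of record `HThm4RecSym152Phi(E)` carries row 9′ «`‖R̄^{j′}(h̄·w·u⁻¹)(y) − 1‖ ≤ Ψ ε j` on the cells of `D″`»; road (B′) pays it by PRE-COMPOSING
Theorem 4's input with a block-constant `SU(N)`-valued `h` (= the junction's cell data `X := R̄^{j′}(g_sr)(y)` on the tower under each cell) and bounding the cross term.  dag-n05-e g42's
F1–F8 re-run the record crown for the pre-composed input `(U₀″)^h` (token substitution on the landed G5–G8, director-ym №314 (g-1)); F8
`B8Prop6DentedCubeMemberScalarGammaSU25PrecompRec.gaugedBoundB8DZ_dentedMember_precomposed_scalar_γ_holds_specialUnitary_of_le` is its `SU(N)` head (`N ≤ 25`).  THIS FILE names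
the ONE shape the junction reads — ✓p735717's `RecordCrownSUBody` with F8's extra binders `(h) (hh : h ∈ SU(N)) (X) (hconst) (ω) (hω) (hoscj) (hosc0)`, threshold
`7dL²·c.M·α₀ + ω ≤ c₁`, the body at `c.fixed U₀ (h⁻¹*u)` ∕ `c.expo η U₀ (h⁻¹*u)` ∕ `(c.vfix U₀)⁻¹*(h⁻¹*u)`, clause 3 `Restr129Z L c.k c.lamS 1 u` UNCHANGED, clause 11's right side
`mlog (avgIterZ L (gaugeAct h (c.axial U₀)) c.k x μ)`, `r = 5dLB₀·(7dL²·c.M·α₀ + ω)` — (v1.1 inhabits it from F8 by ONE `exact`).  The cube instance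
(`propCubePZ` with the empty dent, or a dented `recordCubePZ` — ⚑ LOCATED-TOP-DENT, cell bus 2026-08-29 I.30757 ∕ Q1 answered YES I.30862) is NOT chosen here: the shape is generic in
`c : CubeB8DZ 4 L K Ω`.

WHAT IS DECLARED ∕ PROVED (kernel; axioms standard).
* §1 `RecordCrownSUPrecompBody L N B₀ c₁ ρ₀ M₀ N₀ R₀ : Prop` (`d = 4`), `RecordCrownSUPrecomp L N : Prop := ∃ B₀ c₁ ρ₀ M₀ N₀ R₀, 1 ≤ B₀ ∧ 0 < c₁ ∧ …` — displayed, NEVER asserted.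
* (v1.1, on F8's landing) `recordCrownSUPrecomp_holds_of_le (hN : N ≤ 25) : RecordCrownSUPrecomp F.L N` — ONE `exact` from F8 at `d := 4`, `L := F.L = 2·sL + 1`, `sL ≥ 2`.
HONEST FRAMING: count-neutral; two definitions (displayed premise SHAPES, never asserted; the inhabitant for `N ≤ 25` is dag-n05-e g42's F8, typed, landing delayed by the farm's olean
backlog — appended here the moment it lands); the junction's cell data
`X`, the oscillation letter `ω`, the cross-term inputs and the φ-row are NOT produced here (open list: HOME `pub-ymgap-dag-n07-w3/JUNCTION-PHI-ROAD.md` (σ1)–(σ3)); nothing of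
[3]∕[6]∕[15]∕[I] asserted; `HThm4RecSym152Phi(E)` ∕ `HThm4Rec*` UNDISCHARGED; N05 ∕ N07 NOT discharged; K0⁷ ∕ K1⁹ NOT closed; counts unmoved (typed 28∕28 · discharged 8∕28); one
finite 𝕋⁴ programme at fixed ε — R4 closes the conditional finite-𝕋⁴ rung `BalabanLadder.UV` ONLY; the YM mass gap (Clay) is NOT proved by any of this; nothing continuum ∕ ℝ⁴ ∕ OS.

References: [6] Thm. 4 p. 88, Prop. 6 (1.130)–(1.138) pp. 98–99, (1.29) p. 81, (1.4) p. 77; [15] (144) p. 300, (147)–(153) p. 301; [3] (78)–(81) p. 30, p. 20; [I] (0.3)–(0.6) pp. 252–253.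
-/

set_option autoImplicit false

noncomputable section

open scoped BigOperators Matrix.Norms.L2Operator

namespace Summit.QuantumFields.YangMills.BalabanUVNodes.N07RecordCrownSUPrecomp

open Literature.MathematicalPhysics.QuantumFieldTheory.Balaban1983to89
open Literature.MathematicalPhysics.QuantumFieldTheory.Balaban1983to89.Node00
open Literature.MathematicalPhysics.QuantumLattice (blockMap)
open B14DomainGeom (Pt)
open B8Eq131Cubes (tLo tHi)
open B8Eq131CubesRec (bLoZ bHiZ)
open B7Prop1Explicit (e gaugeAct)
open B7Prop1Local (AgreeOn InBox)
open B7Prop2SpecialUnitary (specialUnitaryUnits)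
open BlockAveragingZd (avgIterZ ctrShift)
open B8Ineq132 (covDerivFwd InAk)
open B8Eq140Level (SideTouches)
open B8Eq138LandauZd (logCfg covLap)
open B8Eq138LandauZdRec (IsLandau138WZ)
open B8Eq119TwistedAxialRec (Restr129Z UnderZ)
open B7SectEFLinearisationRec (logCovIterZ)
open B8Eq184Proof (cfgExp)
open B8ScaledSupNorm (msup bondNorm)
open B8Eq146AExpansion (plaqCovDeriv iEta)
open B8Eq143PlaqExpansion (pdiv)
open B7AvgGaugeCovariance (uLev)
open MatrixLog (mlog)
open T4Continuum (T4Family)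
open N07DatumCrownOfRecordCrown (RecordCrownSUBody RecordCrownSU)

/-! ## §1  The displayed premise shape: the PRE-COMPOSED record crown in its `SU(N)` edition (`d = 4`) -/

/-- **`RecordCrownSUPrecompBody L N B₀ c₁ ρ₀ M₀ N₀ R₀` — THE PRE-COMPOSED RECORD CROWN BODY, `SU(N)` EDITION, `d = 4`** (the shape of dag-n05-e g42's F8 head the junction reads):
✓p735717's `RecordCrownSUBody` VERBATIM with, after `InAk`, the pre-composition binders — `h` `SU(N)`-valued, cell data `X` with `h = X(j, y)` on the block tower under every dented cell
`y ∈ Λ′_j` (`1 ≤ j ≤ k`), an oscillation letter `ω ≥ 0` bounding `h`'s level readings across the (1.35) bonds of every level and across the level-`0` collar bonds — the threshold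
`7·d·L²·c.M·α₀ + ω ≤ c₁`, and the eleven conjuncts READ AT THE TRANSFORMATION `h⁻¹·u` (representative `c.fixed U₀ (h⁻¹*u) = ((U₀″)^h)^{u⁻¹}`, `w′ = (c.vfix U₀)⁻¹*(h⁻¹*u)`), clause 3
`Restr129Z L c.k c.lamS 1 u` EXACT for the Theorem-4 output `u`, clause 11's right side the averages of the pre-composed axial representative `gaugeAct h (c.axial U₀)`, constant
`r = 5dLB₀·(7dL²·c.M·α₀ + ω)`.  A displayed premise SHAPE, NEVER asserted. [cite: Balaban1985RegularSpaces, Prop. 6 (1.135)–(1.138) p.99, p.98, (1.29) p.81, (1.4) p.77; Balaban1985Variational, (148)–(153) p.301; Balaban1985Averaging, p.20, (78)–(81) p.30; Balaban1987RG1, (0.3)–(0.6) pp.252–253] -/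
def RecordCrownSUPrecompBody (L : ℕ) (N : ℕ) (B₀ c₁ ρ₀ M₀ : ℝ) (N₀ R₀ : ℕ) : Prop :=
  letI : CStarAlgebra (MatA N) := {};
  ∀ (η : ℝ), 0 < η → ∀ {K : ℕ} {Ω : ℕ → Set (B7Prop1Explicit.Site 4)} (c : CubeB8DZ 4 L K Ω),
    ∀ (s R : ℕ), 3 ≤ L ^ s → M₀ ≤ (L : ℝ) ^ (s + 1) → L ^ (s + 1) ∣ c.ρ → L ^ (s + 1) ∣ c.M → R * L ^ (s + 1) ≤ c.ρ → 2 * L ≤ R →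
      R₀ ≤ R → N₀ + 1 ≤ R * L ^ (s + 1) → ρ₀ ≤ (c.ρ : ℝ) →
    (∀ x y : B7Prop1Explicit.Site 4,
        blockMap (L ^ (s + 1) * L ^ c.k) (x - fun i => (L : ℤ) ^ c.k * (c.a i - c.ρ) - (ctrShift L c.k : ℤ)) =
          blockMap (L ^ (s + 1) * L ^ c.k) (y - fun i => (L : ℤ) ^ c.k * (c.a i - c.ρ) - (ctrShift L c.k : ℤ)) → x ∈ Ω c.k → y ∈ Ω c.k) →
    ∀ (U₀ : B7Prop1Explicit.Site 4 → Fin 4 → (MatA N)ˣ), (∀ x κ, U₀ x κ ∈ specialUnitaryUnits (Fin N)) → ∀ (α₀ : ℝ), 0 < α₀ → InAk L K η α₀ Ω U₀ →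
    ∀ (h : B7Prop1Explicit.Site 4 → (MatA N)ˣ), (∀ x, h x ∈ specialUnitaryUnits (Fin N)) → ∀ (X : ℕ → B7Prop1Explicit.Site 4 → (MatA N)ˣ),
    (∀ j, 1 ≤ j → j ≤ c.k → ∀ y ∈ c.lamS j, ∀ x, UnderZ L j y x → h x = X j y) → ∀ (ω : ℝ), 0 ≤ ω →
    (∀ j, j ≤ c.k → ∀ (z : B7Prop1Explicit.Site 4) (μ : Fin 4),
      (∀ x, InBox (fun i => (L : ℤ) ^ j * z i - (ctrShift L j : ℤ)) (fun i => (L : ℤ) ^ j * z i + (ctrShift L j : ℤ) + if i = μ then (L : ℤ) ^ j else 0) x →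
        x ∈ c.sq (j - 1)) → ‖((uLev L h j z : (MatA N)ˣ) : MatA N) - ((uLev L h j (z + e μ) : (MatA N)ˣ) : MatA N)‖ ≤ ω) →
    (∀ b ∈ {b : B7Prop1Explicit.Site 4 × Fin 4 | SideTouches (c.sq 0) b.1 b.2},
      ‖((h b.1 : (MatA N)ˣ) : MatA N) - ((h (b.1 + e b.2) : (MatA N)ˣ) : MatA N)‖ ≤ ω) →
    7 * (4 : ℕ) * (L : ℝ) ^ 2 * c.M * α₀ + ω ≤ c₁ →
    ∃ u : B7Prop1Explicit.Site 4 → (MatA N)ˣ, (∀ x, u x ∈ specialUnitaryUnits (Fin N)) ∧ (∀ x, x ∉ c.sq 0 → u x = 1) ∧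
      Restr129Z L c.k c.lamS (1 : B7Prop1Explicit.Site 4 → Fin 4 → (MatA N)ˣ) u ∧
      IsLandau138WZ L c.k η (c.sq 0) c.lamS (1 : B7Prop1Explicit.Site 4 → Fin 4 → (MatA N)ˣ) (c.fixed U₀ (h⁻¹ * u)) ∧
      (∀ j, j ≤ c.k → ∀ b ∈ {b : B7Prop1Explicit.Site 4 × Fin 4 | SideTouches (c.sq j) b.1 b.2},
        c.fixed U₀ (h⁻¹ * u) b.1 b.2 = cfgExp η (logCfg η (c.fixed U₀ (h⁻¹ * u))) b.1 b.2 ∧ IsSelfAdjoint (logCfg η (c.fixed U₀ (h⁻¹ * u)) b.1 b.2) ∧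
          ‖logCfg η (c.fixed U₀ (h⁻¹ * u)) b.1 b.2‖ ≤ (5 * ((4 : ℕ) : ℝ) * L * B₀ * (7 * (4 : ℕ) * (L : ℝ) ^ 2 * c.M * α₀ + ω)) * ((L : ℝ) ^ j * η)⁻¹) ∧
      (∀ x, ((c.vfix U₀)⁻¹ * (h⁻¹ * u)) x ∈ specialUnitaryUnits (Fin N)) ∧
      AgreeOn (B8Ineq130Rec.tlo L (tLo c.a c.ρ) c.k) (B8Ineq130Rec.thi L (tHi c.a c.M c.ρ) c.k) (gaugeAct ((c.vfix U₀)⁻¹ * (h⁻¹ * u))⁻¹ U₀) (c.fixed U₀ (h⁻¹ * u)) ∧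
      msup L c.k η (-(2 : ℝ)) (fun j (t : Fin 4 × Fin 4 × B7Prop1Explicit.Site 4) => SideTouches (c.sq j) t.2.2 t.2.1)
          (fun t => covDerivFwd η (1 : B7Prop1Explicit.Site 4 → Fin 4 → (MatA N)ˣ) t.1 (fun z => c.expo η U₀ (h⁻¹ * u) z t.2.1) t.2.2) ≤
        5 * ((4 : ℕ) : ℝ) * L * B₀ * (7 * (4 : ℕ) * (L : ℝ) ^ 2 * c.M * α₀ + ω) ∧
      bondNorm L c.k η (-(3 : ℝ)) c.sq
          (fun x μ => pdiv η (1 : B7Prop1Explicit.Site 4 → Fin 4 → (MatA N)ˣ) (plaqCovDeriv η (1 : B7Prop1Explicit.Site 4 → Fin 4 → (MatA N)ˣ) (c.expo η U₀ (h⁻¹ * u))) μ x) ≤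
        5 * ((4 : ℕ) : ℝ) * L * B₀ * (7 * (4 : ℕ) * (L : ℝ) ^ 2 * c.M * α₀ + ω) ∧
      bondNorm L c.k η (-(3 : ℝ)) c.sq (fun x μ => covLap η (1 : B7Prop1Explicit.Site 4 → Fin 4 → (MatA N)ˣ) (fun z => c.expo η U₀ (h⁻¹ * u) z μ) x) ≤
        5 * ((4 : ℕ) : ℝ) * L * B₀ * (7 * (4 : ℕ) * (L : ℝ) ^ 2 * c.M * α₀ + ω) ∧
      (∀ (x : B7Prop1Explicit.Site 4) (μ : Fin 4), bLoZ L c.a 0 0 ≤ x → x + e μ ≤ bHiZ L c.a c.M 0 0 → c.inTop x → c.inTop (x + e μ) →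
        logCovIterZ L (1 : B7Prop1Explicit.Site 4 → Fin 4 → (MatA N)ˣ) (iEta η (c.expo η U₀ (h⁻¹ * u))) c.k x μ =
          mlog ((avgIterZ L (gaugeAct h (c.axial U₀)) c.k x μ : (MatA N)ˣ) : MatA N))

/-- **`RecordCrownSUPrecomp L N` — «THERE EXIST CONSTANTS `B₀ ≥ 1`, `c₁ > 0`, `ρ₀, M₀, N₀, R₀`» such that `RecordCrownSUPrecompBody L N B₀ c₁ ρ₀ M₀ N₀ R₀`** — the conclusion shape
of F8 (quantifier prefix = the record crown's).  Displayed, NEVER asserted. [cite: Balaban1985RegularSpaces, Thm. 4 p.88 («there exists a constant c₁»), Prop. 6 p.99; Balaban1985Variational, (152)–(153) p.301; Balaban1987RG1, (0.4) p.253] -/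
def RecordCrownSUPrecomp (L : ℕ) (N : ℕ) : Prop :=
  ∃ B₀ c₁ ρ₀ M₀ : ℝ, ∃ N₀ R₀ : ℕ, 1 ≤ B₀ ∧ 0 < c₁ ∧ RecordCrownSUPrecompBody L N B₀ c₁ ρ₀ M₀ N₀ R₀

/-! ## §2  (v1.1, 2026-08-30, dag-n05-e g43 on dag-n07-w3 g14's offer) The inhabitant for `N ≤ 25`: dag-n05-e g42's F8 ✓p761075 by ONE `exact` -/

/-- ★★★ **THE PRE-COMPOSED `SU(N)` RECORD CROWN INHABITS THE JUNCTION's PREMISE SHAPE `RecordCrownSUPrecomp F.L N` FOR `N ≤ 25`** — dag-n05-e g42's F8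
`B8Prop6DentedCubeMemberScalarGammaSU25PrecompRec.gaugedBoundB8DZ_dentedMember_precomposed_scalar_γ_holds_specialUnitary_of_le` (road (B′) item (B′-4)·4: [6] Prop. 6 ∕ [15]
(148)–(153) for the RECORD structure at every dented centred cube member, for the PRE-COMPOSED Theorem-4 input `(U₀″)^{h}` with `h` `SU(N)`-valued and block-constant under the dented
cells, with the SHARP averaging-closedness of `SU(N)` for the record, `N ≤ 25`) at `d := 4`, `L := F.L = 2·sL + 1` (`F.hL.1`), `sL ≥ 2` (`F.hL11 : 11 < L`) — the sibling of
✓p740700 §3 `N07Thm4RecMemberOfRecordCrownSU.recordCrownSU_holds_of_le` for the pre-composed shape of §1.  Instantiation only; no estimate.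
[cite: Balaban1985RegularSpaces, Prop. 6 (1.135)–(1.138) p.99, p.98, (1.29) p.81; Balaban1985Variational, (148)–(153) p.301; Balaban1985Averaging, p.20, (22)–(23) p.21, (42)–(43) pp.23–24; Balaban1987RG1, (0.3)–(0.4) pp.252–253] -/
theorem recordCrownSUPrecomp_holds_of_le (F : T4Family) (N : ℕ) [NeZero N] (hN : N ≤ 25) : RecordCrownSUPrecomp F.L N := by
  obtain ⟨sL, hsL⟩ := F.hL.1
  have hs2 : 2 ≤ sL := by have := F.hL11; omega
  letI : CStarAlgebra (MatA N) := {}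
  exact B8Prop6DentedCubeMemberScalarGammaSU25PrecompRec.gaugedBoundB8DZ_dentedMember_precomposed_scalar_γ_holds_specialUnitary_of_le
    (d := 4) (by norm_num) hsL hs2 hN

end Summit.QuantumFields.YangMills.BalabanUVNodes.N07RecordCrownSUPrecomp

end
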